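import Mathlib
import Summits.Ventures.HodgeRepro.Statements

/-!
# Free sign patterns for the seesaw data of the sealed statement (b) (seat p2, gen 7)

The slot table `δ_S` of `MuTable` (Statements.lean §B) is computed from the SIGNS of the real numbers
`re w(a₀)`, `re w(a₁)` at the infinite places `w` of the CM field `L` (`a_i ∈ L⁺`, so these are real).
`MuTableWitness.lean` realised three uniform patterns.  This file shows that EVERY pattern occurs: by weak
approximation (`NumberField.InfinitePlace.denseRange_algebraMap_pi`, stated here in sign form for every number field
as `exists_close_to_signs` / `exists_with_signs`) applied to the maximal real subfield `L⁺`,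
for every `ε : InfinitePlace L → Bool` there is a non-zero `a ∈ L` fixed by complex conjugation with
`0 < re w(a) ↔ ε w` at every `w`.  Consequently the discriminants `a₀, a₁` of a seesaw datum can be chosen
with any prescribed pair of sign patterns, so the slot table `δ_S` takes, independently at every place,
any of its three values `0`, `+3·s(w)`, `-3·s(w)` (`s(w) = sign im w(δ)`).
-/

set_option autoImplicit false

namespace Summit.Ventures.HodgeRepro

open NumberField NumberField.InfinitePlace

namespace MuTableSigns

/-- A complex number within `1/2` of `1` has positive real part. -/
theorem re_pos_of_norm_sub_one_lt {z : ℂ} (h : ‖z - 1‖ < 1 / 2) : 0 < z.re := by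
  have h1 : |(z - 1).re| ≤ ‖z - 1‖ := Complex.abs_re_le_norm _
  have h2 : (z - 1).re = z.re - 1 := by simp
  rw [h2] at h1
  have h3 := (abs_lt.1 (h1.trans_lt h)).1
  linarith

/-- A complex number within `1/2` of `-1` has negative real part. -/
theorem re_neg_of_norm_add_one_lt {z : ℂ} (h : ‖z + 1‖ < 1 / 2) : z.re < 0 := by
  have h1 : |(z + 1).re| ≤ ‖z + 1‖ := Complex.abs_re_le_norm _
  have h2 : (z + 1).re = z.re + 1 := by simp
  rw [h2] at h1
  have h3 := (abs_lt.1 (h1.trans_lt h)).2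
  linarith

/-- **Weak approximation in sign form, for every number field `K`**: for every `ε : InfinitePlace K → Bool` there is
`x ∈ K` within `1/2` of `+1` (where `ε w`) or of `-1` (where `¬ ε w`) under the embedding of every infinite place
(`NumberField.InfinitePlace.denseRange_algebraMap_pi`). -/
theorem exists_close_to_signs (K : Type) [Field K] [NumberField K] (ε : InfinitePlace K → Bool) :
    ∃ x : K, ∀ w : InfinitePlace K, ‖w.embedding x - (if ε w = true then 1 else -1)‖ < 1 / 2 := by
  classical
  let t : (v : InfinitePlace K) → WithAbs v.1 := fun v => if ε v = true then 1 else -1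
  let U : Set ((v : InfinitePlace K) → WithAbs v.1) := Set.pi Set.univ fun v => Metric.ball (t v) (1 / 2)
  have hU : IsOpen U := isOpen_set_pi Set.finite_univ fun v _ => Metric.isOpen_ball
  have hne : U.Nonempty := ⟨t, by simp [U]⟩
  obtain ⟨x, hx⟩ := (denseRange_algebraMap_pi K).exists_mem_open hU hne
  refine ⟨x, fun w => ?_⟩
  have hw := (Set.mem_univ_pi.1 hx) w
  rw [Metric.mem_ball, Pi.algebraMap_apply, dist_eq_norm, WithAbs.algebraMap_right_apply] at hw
  simp only [t] at hw
  have key : ∀ c : K, ‖WithAbs.toAbs w.1 (algebraMap K K x) - WithAbs.toAbs _ c‖ = ‖w.embedding x - w.embedding c‖ := by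
    intro c
    rw [← WithAbs.toAbs_sub, WithAbs.norm_toAbs_eq, Algebra.algebraMap_self_apply, ← map_sub, norm_embedding_eq]
    rfl
  by_cases hε : ε w = true
  · rw [if_pos hε]
    rw [if_pos hε] at hw
    have := key 1
    rw [WithAbs.toAbs_one, map_one] at this
    rw [← this]
    exact hw
  · rw [if_neg hε]
    rw [if_neg hε] at hw
    have := key (-1)
    rw [WithAbs.toAbs_neg, WithAbs.toAbs_one, map_neg, map_one] at this
    rw [← this]
    exact hw

/-- **Free signs of the real part, for every number field**: for every `ε` there is `x ≠ 0` with `0 < re w(x) ↔ ε w`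
at every infinite place `w`. -/
theorem exists_with_signs (K : Type) [Field K] [NumberField K] (ε : InfinitePlace K → Bool) :
    ∃ x : K, x ≠ 0 ∧ ∀ w : InfinitePlace K, (0 < (w.embedding x).re ↔ ε w = true) := by
  obtain ⟨x, hx⟩ := exists_close_to_signs K ε
  refine ⟨x, ?_, ?_⟩
  · intro h0
    obtain ⟨w⟩ := (inferInstance : Nonempty (InfinitePlace K))
    have hw := hx w
    rw [h0, map_zero, zero_sub, norm_neg] at hw
    by_cases hε : ε w = true
    · rw [if_pos hε, norm_one] at hw; norm_num at hw
    · rw [if_neg hε, norm_neg, norm_one] at hw; norm_num at hw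
  · intro w
    have hw := hx w
    by_cases hε : ε w = true
    · rw [if_pos hε] at hw
      exact ⟨fun _ => hε, fun _ => re_pos_of_norm_sub_one_lt hw⟩
    · rw [if_neg hε, sub_neg_eq_add] at hw
      have := re_neg_of_norm_add_one_lt hw
      exact ⟨fun h => absurd h (not_lt.2 this.le), fun h => absurd h hε⟩

variable {L : Type} [Field L] [NumberField L] [NumberField.IsCMField L]

/-- Weak approximation in `L⁺`, read at the places of `L`: for every `ε` there is `x ∈ L⁺` whose image in `L`
is within `1/2` of `+1` (where `ε w`) or of `-1` (where `¬ ε w`) under every `w.embedding` (`exists_close_to_signs`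
for `L⁺`, transported along `IsCMField.equivInfinitePlace` = restriction of places). -/
theorem exists_real_close_to_signs (ε : InfinitePlace L → Bool) :
    ∃ x : maximalRealSubfield L, ∀ w : InfinitePlace L,
      ‖w.embedding (algebraMap (maximalRealSubfield L) L x) - (if ε w = true then 1 else -1)‖ < 1 / 2 := by
  obtain ⟨x, hx⟩ := exists_close_to_signs (maximalRealSubfield L)
    (fun v => ε ((IsCMField.equivInfinitePlace L).symm v))
  refine ⟨x, fun w => ?_⟩
  have hw := hx (IsCMField.equivInfinitePlace L w)
  rw [Equiv.symm_apply_apply] at hw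
  -- `‖v.embedding y‖ = v y = w (algebraMap y)` for `v = w.comap (algebraMap L⁺ L)`
  have key : ∀ c : maximalRealSubfield L,
      ‖(IsCMField.equivInfinitePlace L w).embedding x - (IsCMField.equivInfinitePlace L w).embedding c‖
        = ‖w.embedding (algebraMap (maximalRealSubfield L) L x) - w.embedding (algebraMap (maximalRealSubfield L) L c)‖ := by
    intro c
    rw [← map_sub, norm_embedding_eq, IsCMField.equivInfinitePlace_apply, comap_apply, ← norm_embedding_eq, map_sub,
      map_sub]
  by_cases hε : ε w = true
  · rw [if_pos hε]
    rw [if_pos hε] at hw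
    have := key 1
    simp only [map_one] at this
    rw [← this]
    exact hw
  · rw [if_neg hε]
    rw [if_neg hε] at hw
    have := key (-1)
    simp only [map_neg, map_one] at this
    rw [← this]
    exact hw

/-- **Free signs in a CM field.**  For every sign pattern `ε` on the infinite places of `L` there is a non-zero
`a ∈ L` fixed by complex conjugation (i.e. `a ∈ L⁺`) with `0 < re w(a) ↔ ε w` at every place `w`. -/
theorem exists_conj_fixed_with_signs (ε : InfinitePlace L → Bool) :
    ∃ a : L, IsCMField.complexConj L a = a ∧ a ≠ 0 ∧
      ∀ w : InfinitePlace L, (0 < (w.embedding a).re ↔ ε w = true) := by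
  obtain ⟨x, hx⟩ := exists_real_close_to_signs (L := L) ε
  refine ⟨algebraMap (maximalRealSubfield L) L x, IsCMField.complexConj_apply_eq_self L x, ?_, ?_⟩
  · intro h0
    obtain ⟨w⟩ := (inferInstance : Nonempty (InfinitePlace L))
    have hw := hx w
    rw [h0, map_zero, zero_sub, norm_neg] at hw
    by_cases hε : ε w = true
    · rw [if_pos hε, norm_one] at hw; norm_num at hw
    · rw [if_neg hε, norm_neg, norm_one] at hw; norm_num at hw
  · intro w
    have hw := hx w
    by_cases hε : ε w = true
    · rw [if_pos hε] at hw
      exact ⟨fun _ => hε, fun _ => re_pos_of_norm_sub_one_lt hw⟩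
    · rw [if_neg hε, sub_neg_eq_add] at hw
      have := re_neg_of_norm_add_one_lt hw
      exact ⟨fun h => absurd h (not_lt.2 this.le), fun h => absurd h hε⟩

end MuTableSigns

end Summit.Ventures.HodgeRepro
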